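import Summits.HubbardSuperconductivity.HubbardSuperconductivity.Theorems.AposterioriCapRgSeededBrokenRegimeBoseFermiPinnedKernelCalculus
import Summits.HubbardSuperconductivity.HubbardSuperconductivity.Theorems.AposterioriCapRgSeededBrokenRegimeBoseFermiPinnedLegKernelNormAddLe

/-!
# The `L¹–L^∞` estimate of the Laplacian (contraction) term of Polchinski's equation
# (crux `SeededBrokenRegimeBoseFermiPinned` = stmt-HubbardSuperconductivity-14047, route AposterioriCapRg; supports, lead c4; stub `stub_legKernelNormLaplacianLe`)

WHAT. The Gawȩdzki–Kupiainen / Salmhofer power-counting bound for the CONTRACTION term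
`Δ_C F` of Polchinski's equation in the leg-weighted `L¹–L^∞` kernel norm `legKernelNorm`
(`Literature/MathematicalPhysics/QuantumLattice/HubbardScaleReport.lean`, §3) of Salmhofer's
kernels `weightedKernel ε` (`GrassmannKernels.lean`): if the covariance is dominated leg-wise,
`‖C X Y‖ ≤ c · wt X · wt Y`, then for every degree `m + 1 ≥ 1`
`‖(Δ_C F)_{m+1}‖_{wt,ε} ≤ ((m+3)(m+2)/2) · c · ‖F_{m+3}‖_{wt,ε}`:
contracting two legs of `F_{m+3}` through `C` costs `sup |C| / (wt ⊗ wt) = c` and the number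
`(m+3)(m+2)/2` of (unordered) pairs of legs, uniformly in the number of field labels.

HOW. By the closed form of the kernels of `Δ_C F`
(`KernelCalculus.kernel_grassmannLaplacian`, landed:
`kernel (Δ_C F) (m+1) Z = ½ (m+3)(m+2) Σ_{X,Y} C X Y · kernel F (m+3) (Y, X, Z)`), every weighted
term of the left-hand norm is bounded by `½ (m+3)(m+2) · Σ_{X,Y} c · (wt Y · wt X · ∏ wt Z) ·
‖kernel F (m+3) (Y, X, Z)‖` (`c` only ever multiplies the nonnegative product `wt X · wt Y`).
Summing over the fibre `{Z : Z p = x}` of a pinned leg `p` with label `x` and reindexing by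
`W = (Y, X, Z)` (`pinnedSum_cons_cons`: `(Y, X, Z) ↦ W` is a bijection from `Γ × Γ × {Z : Z p = x}`
onto the fibre `{W : W (p+2) = x}`, and `∏ wt W = wt Y · wt X · ∏ wt Z`) turns the bound into
`½ (m+3)(m+2) · c ·` (the pinned sum of `F`'s `(m+3)`-kernel at leg `p + 2`, label `x`), which is at
most the norm (`LegKernelNormAlgebra.pinnedSum_le_legKernelNorm`, landed); the powers of `ε` match
(`ε^m · ε^{-(m+1)} = ε^{-1} = ε^{m+2} · ε^{-(m+3)}`), and the norm of `Δ_C F` is at most any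
nonnegative bound of all its pinned sums (`LegKernelNormAlgebra.legKernelNorm_succ_le_of_forall`).
The sign of `c` is not assumed: if `c < 0` the hypothesis forces every weight to vanish and both
sides are `0`.

SOURCES. M. Salmhofer, Commun. Math. Phys. 194 (1998) 249–295, §4.1, proof of Lemma 1 (the
contraction step) [`Salmhofer1998`]; K. Gawȩdzki, A. Kupiainen, Commun. Math. Phys. 102 (1985) 1,
§3.  Finite-dimensional bookkeeping; folklore.

The file proves the generic lemmas over any `RCLike` scalar field and any finite label type in the
sub-namespace `LaplacianNormBound`, then the registered stub (scalars `ℂ`).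
-/

set_option linter.dupNamespace false -- `Summit.<S>.<S>` doubles the summit name (tree convention)

namespace Summit.HubbardSuperconductivity.HubbardSuperconductivity.Theorems.AposterioriCapRgSeededBrokenRegimeBoseFermiPinned

open Literature.MathematicalPhysics.QuantumLattice GrassmannAlgebra

namespace LaplacianNormBound

variable {𝕜 : Type*} [RCLike 𝕜] {Γ : Type*}

/-- The `ε`-bookkeeping of the estimate: `ε^m · ε^{-(m+1)} = ε^{-1} = ε^{m+2} · ε^{-(m+3)}` for
`ε > 0`, in the shape it is used. [folklore] -/
theorem eps_bookkeeping {ε : ℝ} (hε : 0 < ε) (m : ℕ) (a R : ℝ) :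
    ε ^ m * (ε⁻¹ ^ (m + 1) * (a * R)) = a * (ε ^ (m + 2) * (ε⁻¹ ^ (m + 3) * R)) := by
  have h1 : ε ^ m * ε⁻¹ ^ (m + 1) = ε⁻¹ := by
    rw [pow_succ, ← mul_assoc, ← mul_pow, mul_inv_cancel₀ hε.ne', one_pow, one_mul]
  have h2 : ε ^ (m + 2) * ε⁻¹ ^ (m + 3) = ε⁻¹ := by
    rw [show ε⁻¹ ^ (m + 3) = ε⁻¹ ^ (m + 2) * ε⁻¹ from pow_succ ε⁻¹ (m + 2), ← mul_assoc, ← mul_pow,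
      mul_inv_cancel₀ hε.ne', one_pow, one_mul]
  calc ε ^ m * (ε⁻¹ ^ (m + 1) * (a * R)) = ε ^ m * ε⁻¹ ^ (m + 1) * (a * R) := by ring
    _ = ε ^ (m + 2) * ε⁻¹ ^ (m + 3) * (a * R) := by rw [h1, h2]
    _ = a * (ε ^ (m + 2) * (ε⁻¹ ^ (m + 3) * R)) := by ring

/-- The norm of the scalar prefactor `½ (m+3)(m+2)` of `kernel (Δ_C F) (m+1)`. [folklore] -/
theorem norm_prefactor (m : ℕ) :
    ‖((1 / 2 : ℚ) • (1 : 𝕜)) * (((m + 1 + 2) * (m + 1 + 1) : ℕ) : 𝕜)‖ = ((m + 3) * (m + 2) / 2 : ℝ) := by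
  have h2 : ‖((1 / 2 : ℚ) : 𝕜)‖ = 1 / 2 := by simp
  rw [norm_mul, Rat.smul_one_eq_cast, h2, RCLike.norm_natCast]
  push_cast
  ring

/-- The leg weights of `(Y, X, Z)`: `∏ wt (Y, X, Z) = wt Y · (wt X · ∏ wt Z)`. [folklore] -/
theorem prod_cons_cons (wt : Γ → ℝ) {m : ℕ} (Y X : Γ) (Z : Fin (m + 1) → Γ) :
    ∏ q, wt ((Fin.cons Y (Fin.cons X Z) : Fin (m + 3) → Γ) q) = wt Y * (wt X * ∏ q, wt (Z q)) := by
  rw [Fin.prod_univ_succ, Fin.prod_univ_succ]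
  simp only [Fin.cons_zero, Fin.cons_succ]

/-- A weighted sum of Salmhofer's kernels `G_n = ε^{-n} F_n` is `ε^{-n}` times that of the plain
kernels (`ε ≥ 0`). [folklore] -/
theorem sum_weightedKernel (wt : Γ → ℝ) {ε : ℝ} (hε : 0 ≤ ε) (G : GrassmannAlgebra 𝕜 Γ) (n : ℕ)
    (s : Finset (Fin n → Γ)) :
    ∑ Z ∈ s, (∏ q, wt (Z q)) * ‖weightedKernel ε G n Z‖ =
      ε⁻¹ ^ n * ∑ Z ∈ s, (∏ q, wt (Z q)) * ‖kernel 𝕜 G n Z‖ := by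
  rw [Finset.mul_sum]
  refine Finset.sum_congr rfl fun Z _ => ?_
  rw [weightedKernel_def, norm_mul, RCLike.norm_ofReal, abs_of_nonneg (pow_nonneg (inv_nonneg.2 hε) n)]
  ring

variable [Fintype Γ]

/-- Splitting a sum over words of length `n + 1` according to the first letter (`Fin.consEquiv`).
[folklore] -/
theorem sum_cons {M : Type*} [AddCommMonoid M] {n : ℕ} (g : (Fin (n + 1) → Γ) → M) :
    ∑ W, g W = ∑ Y : Γ, ∑ W' : Fin n → Γ, g (Fin.cons Y W') := by
  -- adapted from `sum_word_succ` (Literature/Analysis/FluidPDE/CoordDerivatives.lean)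
  rw [← Fintype.sum_prod_type']
  exact (Fintype.sum_equiv (Fin.consEquiv fun _ => Γ) _ _ fun q => rfl).symm

/-- **Pointwise bound for the kernels of `Δ_C F`**:
`‖kernel (Δ_C F) (m+1) Z‖ ≤ ½ (m+3)(m+2) Σ_{X,Y} ‖C X Y‖ · ‖kernel F (m+3) (Y, X, Z)‖`
(from the closed form `KernelCalculus.kernel_grassmannLaplacian` and the triangle inequality).
[cite: Salmhofer1998, §4.1] -/
theorem norm_kernel_laplacian_le (C : Matrix Γ Γ 𝕜) (F : GrassmannAlgebra 𝕜 Γ) (m : ℕ)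
    (Z : Fin (m + 1) → Γ) :
    ‖kernel 𝕜 (grassmannLaplacian 𝕜 C F) (m + 1) Z‖ ≤
      ((m + 3) * (m + 2) / 2 : ℝ) *
        ∑ X, ∑ Y, ‖C X Y‖ * ‖kernel 𝕜 F (m + 3) (Fin.cons Y (Fin.cons X Z))‖ := by
  rw [KernelCalculus.kernel_grassmannLaplacian, norm_mul, norm_prefactor]
  refine mul_le_mul_of_nonneg_left ((norm_sum_le _ _).trans (Finset.sum_le_sum fun X _ =>
    (norm_sum_le _ _).trans (Finset.sum_le_sum fun Y _ => (norm_mul _ _).le))) (by positivity)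

/-- **Weighted pointwise bound**: for nonnegative weights and `‖C X Y‖ ≤ c · wt X · wt Y`,
`(∏ wt Z) · ‖kernel (Δ_C F) (m+1) Z‖ ≤ ½ (m+3)(m+2) · c · Σ_{X,Y} (wt Y · wt X · ∏ wt Z) ·
‖kernel F (m+3) (Y, X, Z)‖` — `c` only multiplies the nonnegative `wt X · wt Y`, so no sign
assumption on `c` is needed. [cite: Salmhofer1998, §4.1] -/
theorem weight_mul_norm_kernel_laplacian_le {wt : Γ → ℝ} (hwt : ∀ X, 0 ≤ wt X) (C : Matrix Γ Γ 𝕜)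
    (c : ℝ) (hC : ∀ X Y, ‖C X Y‖ ≤ c * (wt X * wt Y)) (F : GrassmannAlgebra 𝕜 Γ) (m : ℕ)
    (Z : Fin (m + 1) → Γ) :
    (∏ q, wt (Z q)) * ‖kernel 𝕜 (grassmannLaplacian 𝕜 C F) (m + 1) Z‖ ≤
      ((m + 3) * (m + 2) / 2 : ℝ) * c * ∑ X, ∑ Y,
        (wt Y * (wt X * ∏ q, wt (Z q))) * ‖kernel 𝕜 F (m + 3) (Fin.cons Y (Fin.cons X Z))‖ := by
  have hw : 0 ≤ ∏ q, wt (Z q) := Finset.prod_nonneg fun q _ => hwt _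
  have hA : (0 : ℝ) ≤ ((m + 3) * (m + 2) / 2 : ℝ) := by positivity
  have h2 : ∑ X, ∑ Y, ‖C X Y‖ * ‖kernel 𝕜 F (m + 3) (Fin.cons Y (Fin.cons X Z))‖ ≤
      ∑ X, ∑ Y, c * (wt X * wt Y) * ‖kernel 𝕜 F (m + 3) (Fin.cons Y (Fin.cons X Z))‖ :=
    Finset.sum_le_sum fun X _ => Finset.sum_le_sum fun Y _ =>
      mul_le_mul_of_nonneg_right (hC X Y) (norm_nonneg _)
  calc (∏ q, wt (Z q)) * ‖kernel 𝕜 (grassmannLaplacian 𝕜 C F) (m + 1) Z‖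
      ≤ (∏ q, wt (Z q)) * (((m + 3) * (m + 2) / 2 : ℝ) *
          ∑ X, ∑ Y, c * (wt X * wt Y) * ‖kernel 𝕜 F (m + 3) (Fin.cons Y (Fin.cons X Z))‖) :=
        mul_le_mul_of_nonneg_left ((norm_kernel_laplacian_le C F m Z).trans
          (mul_le_mul_of_nonneg_left h2 hA)) hw
    _ = ((m + 3) * (m + 2) / 2 : ℝ) * c * ∑ X, ∑ Y,
          (wt Y * (wt X * ∏ q, wt (Z q))) * ‖kernel 𝕜 F (m + 3) (Fin.cons Y (Fin.cons X Z))‖ := by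
        simp only [Finset.mul_sum]
        refine Finset.sum_congr rfl fun X _ => Finset.sum_congr rfl fun Y _ => ?_
        ring

variable [DecidableEq Γ]

/-- **Reindexing a pinned fibre two legs down**: summing `g` over `{W : W (p+2) = x}` is summing
`g (Y, X, Z)` over all `X, Y` and `{Z : Z p = x}` (`W = (Y, X, Z)` is a bijection). [folklore] -/
theorem pinnedSum_cons_cons {M : Type*} [AddCommMonoid M] {m : ℕ} (g : (Fin (m + 3) → Γ) → M)
    (p : Fin (m + 1)) (x : Γ) :
    ∑ W ∈ Finset.univ.filter (fun W : Fin (m + 3) → Γ => W p.succ.succ = x), g W =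
      ∑ X : Γ, ∑ Y : Γ, ∑ Z ∈ Finset.univ.filter (fun Z : Fin (m + 1) → Γ => Z p = x),
        g (Fin.cons Y (Fin.cons X Z)) := by
  rw [Finset.sum_comm, Finset.sum_filter, sum_cons]
  refine Finset.sum_congr rfl fun Y _ => ?_
  rw [sum_cons]
  refine Finset.sum_congr rfl fun X _ => ?_
  simp only [Finset.sum_filter, Fin.cons_succ]

/-- **The pinned `L¹–L^∞` estimate for the kernels of `Δ_C F`** (plain kernels, no `ε`): the
weighted sum of `‖kernel (Δ_C F) (m+1)‖` over the fibre `{Z : Z p = x}` is at most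
`½ (m+3)(m+2) · c ·` the weighted sum of `‖kernel F (m+3)‖` over the fibre `{W : W (p+2) = x}`.
[cite: Salmhofer1998, §4.1] -/
theorem pinnedSum_kernel_laplacian_le {wt : Γ → ℝ} (hwt : ∀ X, 0 ≤ wt X) (C : Matrix Γ Γ 𝕜)
    (c : ℝ) (hC : ∀ X Y, ‖C X Y‖ ≤ c * (wt X * wt Y)) (F : GrassmannAlgebra 𝕜 Γ) (m : ℕ)
    (p : Fin (m + 1)) (x : Γ) :
    ∑ Z ∈ Finset.univ.filter (fun Z : Fin (m + 1) → Γ => Z p = x),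
        (∏ q, wt (Z q)) * ‖kernel 𝕜 (grassmannLaplacian 𝕜 C F) (m + 1) Z‖ ≤
      ((m + 3) * (m + 2) / 2 : ℝ) * c *
        ∑ W ∈ Finset.univ.filter (fun W : Fin (m + 3) → Γ => W p.succ.succ = x),
          (∏ q, wt (W q)) * ‖kernel 𝕜 F (m + 3) W‖ := by
  rw [pinnedSum_cons_cons (fun W : Fin (m + 3) → Γ => (∏ q, wt (W q)) * ‖kernel 𝕜 F (m + 3) W‖) p x]
  simp only [prod_cons_cons]
  refine (Finset.sum_le_sum fun Z _ => weight_mul_norm_kernel_laplacian_le hwt C c hC F m Z).trans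
    (le_of_eq ?_)
  rw [← Finset.mul_sum, Finset.sum_comm]
  exact congrArg _ (Finset.sum_congr rfl fun X _ => Finset.sum_comm)

/-- If every weight vanishes, the leg-weighted norm in positive degree is `0`. [folklore] -/
theorem legKernelNorm_succ_eq_zero_of_wt {wt : Γ → ℝ} (hw : ∀ X, wt X = 0) (ε : ℝ) (n : ℕ)
    (K : (Fin (n + 1) → Γ) → 𝕜) : legKernelNorm wt ε (n + 1) K = 0 := by
  rw [legKernelNorm_succ]
  have h0 : ∀ X : Fin (n + 1) → Γ, (∏ q, wt (X q)) * ‖K X‖ = 0 := fun X => by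
    rw [Finset.prod_eq_zero (Finset.mem_univ (0 : Fin (n + 1))) (hw (X 0)), zero_mul]
  simp only [h0, Finset.sum_const_zero, mul_zero, Real.iSup_const_zero]

/-- **The `L¹–L^∞` estimate for the Laplacian term of Polchinski's equation** (generic labels and
scalars): for nonnegative leg weights `wt`, `ε > 0` and a covariance dominated leg-wise by
`‖C X Y‖ ≤ c · wt X · wt Y`,
`‖(Δ_C F)_{m+1}‖_{wt,ε} ≤ ((m+3)(m+2)/2) · c · ‖F_{m+3}‖_{wt,ε}` in Salmhofer's kernels
`weightedKernel ε`. [cite: Salmhofer1998, §4.1] -/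
theorem legKernelNorm_laplacian_le {wt : Γ → ℝ} (hwt : ∀ X, 0 ≤ wt X) {ε : ℝ} (hε : 0 < ε)
    (C : Matrix Γ Γ 𝕜) (c : ℝ) (hC : ∀ X Y, ‖C X Y‖ ≤ c * (wt X * wt Y)) (F : GrassmannAlgebra 𝕜 Γ)
    (m : ℕ) :
    legKernelNorm wt ε (m + 1) (weightedKernel ε (grassmannLaplacian 𝕜 C F) (m + 1)) ≤
      ((m + 3) * (m + 2) / 2 : ℝ) * c * legKernelNorm wt ε (m + 3) (weightedKernel ε F (m + 3)) := by
  rcases le_or_gt 0 c with hc | hc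
  · have hA : (0 : ℝ) ≤ ((m + 3) * (m + 2) / 2 : ℝ) * c := mul_nonneg (by positivity) hc
    refine LegKernelNormAlgebra.legKernelNorm_succ_le_of_forall wt ε m _
      (mul_nonneg hA (legKernelNorm_nonneg hwt hε.le _ _)) fun p x => ?_
    rw [sum_weightedKernel wt hε.le]
    refine (mul_le_mul_of_nonneg_left (mul_le_mul_of_nonneg_left
      (pinnedSum_kernel_laplacian_le hwt C c hC F m p x) (pow_nonneg (inv_nonneg.2 hε.le) _))
      (pow_nonneg hε.le _)).trans ?_
    rw [eps_bookkeeping hε, ← sum_weightedKernel wt hε.le]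
    exact mul_le_mul_of_nonneg_left
      (LegKernelNormAlgebra.pinnedSum_le_legKernelNorm wt ε (m + 2) _ _ x) hA
  · -- `c < 0` forces every weight to vanish, and then both sides are `0`
    have hw : ∀ X, wt X = 0 := fun X => by
      by_contra hne
      have hpos : 0 < wt X * wt X := mul_pos ((hwt X).lt_of_ne' hne) ((hwt X).lt_of_ne' hne)
      exact absurd ((norm_nonneg _).trans (hC X X)) (not_le.2 (mul_neg_of_neg_of_pos hc hpos))
    have h1 := legKernelNorm_succ_eq_zero_of_wt (𝕜 := 𝕜) hw ε m
      (weightedKernel ε (grassmannLaplacian 𝕜 C F) (m + 1))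
    have h3 := legKernelNorm_succ_eq_zero_of_wt (𝕜 := 𝕜) hw ε (m + 2) (weightedKernel ε F (m + 3))
    rw [h1, h3, mul_zero]

end LaplacianNormBound

/-! ### The registered stub -/

/-- **V1 (`stub_legKernelNormLaplacianLe`)**: the `L¹–L^∞` estimate, in Salmhofer's leg-weighted
norm, of the Laplacian (contraction) term `Δ_C F` of Polchinski's equation:
`‖(Δ_C F)_{m+1}‖_{wt,ε} ≤ ((m+3)(m+2)/2) · c · ‖F_{m+3}‖_{wt,ε}` whenever `‖C X Y‖ ≤ c · wt X · wt Y`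
(nonnegative weights, `ε > 0`, complex scalars, any finite label type). [cite: Salmhofer1998, §4.1] -/
theorem stub_legKernelNormLaplacianLe :
    ∀ {Γ : Type} [Fintype Γ] [DecidableEq Γ] (wt : Γ → ℝ), (∀ X, 0 ≤ wt X) → ∀ {ε : ℝ}, 0 < ε →
      ∀ (C : Matrix Γ Γ ℂ) (c : ℝ), (∀ X Y, ‖C X Y‖ ≤ c * (wt X * wt Y)) → ∀ (F : GrassmannAlgebra ℂ Γ) (m : ℕ),
        legKernelNorm wt ε (m + 1) (weightedKernel ε (grassmannLaplacian ℂ C F) (m + 1)) ≤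
          ((m + 3) * (m + 2) / 2 : ℝ) * c * legKernelNorm wt ε (m + 3) (weightedKernel ε F (m + 3)) := by
  intro Γ _ _ wt hwt ε hε C c hC F m
  exact LaplacianNormBound.legKernelNorm_laplacian_le hwt hε C c hC F m

end Summit.HubbardSuperconductivity.HubbardSuperconductivity.Theorems.AposterioriCapRgSeededBrokenRegimeBoseFermiPinned
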